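import Summits.CriticalPhenomena.SAWScalingLimit.Theorems.SAWLoopFugacityFlowSimpleSubseqLimitsStubRangeIsArcTransfer
import Summits.CriticalPhenomena.SAWScalingLimit.Theorems.SAWLoopFugacityFlowSimpleSubseqLimitsStubRangeIsArcBoundary
import Summits.CriticalPhenomena.SAWScalingLimit.Theorems.SAWLoopFugacityFlowSimpleSubseqLimitsStubRangeIsArcTests
import Summits.CriticalPhenomena.SAWScalingLimit.Theorems.SAWLoopFugacityFlowSimpleSubseqLimitsLineGlue
import HarnessLib

/-!
# SHAPE — `stub_rangeIsArc` of the line `marked-point-revisit`, glued from its three sub-stubs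
(crux `SAWLoopFugacityFlow.SimpleSubseqLimits`, stmt-CriticalPhenomena-4982; plan `RangeIsArc-PLAN.md`, §3 GLUE)

`stub_rangeIsArc` (two probability measures on curve classes — `ν` carried by classes from `a`
to `b` inside `cl D`, `μ` carried by simple chords meeting `∂D` only at `a, b` — which agree on
the avoidance events of all inline hull subdomains (`AvoidanceAgree`) have `ν`-a.e. class with the
RANGE of a simple chord, `HasArcRange`) from:

* `ArcRangeBoundary.stub_rangeIsArc_boundary` — `ν`-a.e. the range meets `∂D` only at `a, b`;
* `ArcRangeTests.stub_rangeIsArc_tests` — a closed test family whose avoidance code is injective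
  on the chordal carrier, on whose finite-union avoidance events `ν = μ`, and which determines the
  trace of a carrier class against a chordal simple class;
* `ArcRange.stub_rangeIsArc_transfer` — Lusin–Souslin transfer: `ν`-a.e. class has the code of
  a chordal simple class.

Vocabulary (`HasArcRange`, `AvoidanceAgree`) from the landed `…LineGlue` (`Glue` namespace).
-/

noncomputable section

open MeasureTheory Filter Topology Set Metric
open Literature.Probability.RandomPlanarGeometry
open Summit.CriticalPhenomena.SAWScalingLimit.Theorems.SimpleSubseqLimits.MarkedPointRevisit.Glue
open scoped ENNReal NNReal unitInterval

namespace Summit.CriticalPhenomena.SAWScalingLimit.Theorems.SimpleSubseqLimits.MarkedPointRevisit.ArcRangeGlue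

/-- A subset of `closure D` meeting `∂D` only inside `{a, b}` lies in `D ∪ {a, b}`. [folklore] -/
theorem subset_carrier_union {D : DobrushinDomain} {R : Set ℂ} (h1 : R ⊆ closure D.carrier)
    (h2 : R ∩ frontier D.carrier ⊆ {D.pt 0, D.pt 1}) : R ⊆ D.carrier ∪ {D.pt 0, D.pt 1} := by
  intro w hw
  have h3 := h1 hw
  rw [closure_eq_self_union_frontier] at h3
  rcases h3 with h3 | h3
  · exact Or.inl h3
  · exact Or.inr (h2 ⟨hw, h3⟩)

/-- A subset of `D ∪ {a, b}` lies in `closure D` and meets `∂D` only inside `{a, b}`. [folklore] -/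
theorem closure_and_frontier {D : DobrushinDomain} {R : Set ℂ}
    (h : R ⊆ D.carrier ∪ {D.pt 0, D.pt 1}) :
    R ⊆ closure D.carrier ∧ R ∩ frontier D.carrier ⊆ {D.pt 0, D.pt 1} := by
  constructor
  · intro w hw
    rcases h hw with hw' | hw'
    · exact subset_closure hw'
    · rcases hw' with rfl | rfl <;> exact frontier_subset_closure (D.pt_mem_frontier _)
  · rintro w ⟨hw, hwfr⟩
    rcases h hw with hw' | hw'
    · have := hwfr.2
      rw [D.isOpen.interior_eq] at this
      exact absurd hw' this
    · exact hw'

/-- **Stub 3 of the line `marked-point-revisit` — SHAPE: the range is an arc** (composition of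
the three registered sub-stubs: boundary clause `ArcRangeBoundary.stub_rangeIsArc_boundary`,
test family `ArcRangeTests.stub_rangeIsArc_tests`, transfer `ArcRange.stub_rangeIsArc_transfer`).
`ν`-a.e. class `c` lies in the carrier `{a → b inside D ∪ {a, b}}` (boundary clause); the transfer
along the avoidance code of the test family gives a chordal simple class `γ` with the same code,
the last clause of the test-family stub gives `c.range = γ.range`, and `γ` witnesses
`HasArcRange D c`. [folklore] -/
theorem stub_rangeIsArc :
    ∀ (D : DobrushinDomain) (ν μ : Measure (CurveClass ℂ)), IsProbabilityMeasure ν →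
      IsProbabilityMeasure μ →
      (∀ᵐ c ∂ν, c.source = D.pt 0 ∧ c.target = D.pt 1 ∧ c.range ⊆ closure D.carrier) →
      (∀ᵐ γ ∂μ, γ ∈ CurveClass.simple ∧ γ.source = D.pt 0 ∧ γ.target = D.pt 1 ∧
        γ.range ⊆ closure D.carrier ∧ γ.range ∩ frontier D.carrier ⊆ {D.pt 0, D.pt 1}) →
      AvoidanceAgree D ν μ → ∀ᵐ c ∂ν, HasArcRange D c := by
  intro D ν μ hνP hμP hν hμ hA
  have hb := ArcRangeBoundary.stub_rangeIsArc_boundary D ν μ hνP hμP hν hμ hA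
  have hν' : ∀ᵐ c ∂ν, c.source = D.pt 0 ∧ c.target = D.pt 1 ∧
      c.range ⊆ D.carrier ∪ {D.pt 0, D.pt 1} := by
    filter_upwards [hν, hb] with c hc hcb
    exact ⟨hc.1, hc.2.1, subset_carrier_union hc.2.2 hcb⟩
  have hμ' : ∀ᵐ γ ∂μ, γ ∈ chordalCarrier D := by
    filter_upwards [hμ] with γ h
    exact ⟨⟨⟨h.1, h.2.1⟩, h.2.2.1⟩, subset_carrier_union h.2.2.2.1 h.2.2.2.2⟩
  obtain ⟨C, hC, hinj, hagree, hsep⟩ := ArcRangeTests.stub_rangeIsArc_tests D ν μ hνP hμP hν' hμ' hA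
  have ht := ArcRange.stub_rangeIsArc_transfer C (chordalCarrier D) ν μ inferInstance inferInstance
    hC measurableSet_chordalCarrier hinj hμ' hagree
  filter_upwards [ht, hν'] with c hc hcar
  obtain ⟨γ, hγ, hcode⟩ := hc
  have hr : c.range = γ.range := hsep c hcar.1 hcar.2.1 hcar.2.2 γ hγ hcode
  obtain ⟨hcl, hfr⟩ := closure_and_frontier hγ.2
  exact ⟨γ, hγ.1.1.1, hγ.1.1.2, hγ.1.2, hcl, hfr, hr.symm⟩

end Summit.CriticalPhenomena.SAWScalingLimit.Theorems.SimpleSubseqLimits.MarkedPointRevisit.ArcRangeGlue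

end
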